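import Mathlib
import Summits.NavierStokesRegularity.NavierStokesRegularity.Theorems.FilamentSkeletonRssClause13WindowPieceSup

/-!
# Clause 13-J/13-R, brick m3b-T′ (SUP OF THE TRANSITION PIECE `P_T = (t k′ + k)∗Y` THROUGH THE WINDOW GAIN)

Route `FilamentSkeletonRss`, ∃-side clause 13 (`Clause13RNearStraightL`, stmt-NavierStokesRegularity-23612; typing-agnostic).  Design of record
rev 80–82 (m3b; "transition commutator via window gain") and lane memo `DESIGN-28296-model-Linfty-g18.md` §6.  The `L∞` statements
`model_pointwise(_weighted)` (p721438 / p722938) take `S_T ≥ sup_{ball}‖P_T‖` as an input, `P_T(x) = ∫((x−y)k′(x−y) + k(x−y))Y(y)dy` being the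
TRANSITION PIECE of the near kernel `k` (profile `−zχ′(z)`, supported where `κ_M ≤ (2/q)𝔖`, exactly the hypothesis `hTsym` of `model_l2_estimate`,
p709153).  This file instantiates `normSq_windowPiece_le` (p718744) at the transition kernel `g = t k′ + k` (`g′ = 2k′ + t k″`,
`g″ = 3k″ + t k‴`; `k ∈ C³`):
* §1 `hasDerivAt_transitionKernel`, `hasDerivAt_transitionKernel_deriv` — the derivative bookkeeping;
* §2 ★ `transitionPiece_normSq_le` — `G·κ_M·‖P_T(x)‖² ≤ √(E_g · E_{g′})` at every `x`, with `E_g`, `E_{g′}` the right sides of the window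
  estimate for `g` and `g′` (moments `‖g‖₁, ‖t g‖₁, ‖g′‖₁, ‖t g′‖₁, ‖g″‖₁, ‖t g″‖₁`, stated on the composite expressions as in p709153's `bTM…`).
Hence `S_T := ((E_g E_{g′})^{1/2}/(Gκ_M))^{1/2}` is an admissible input of the `L∞` layer — in MODEL currency (`N(𝓛Y)`, `N(Y)`, `N((τ−c)Y)`).
Lane ns-filament-19175-p1 g18; `--supports stmt-NavierStokesRegularity-23612 --as helper`.
HONEST FRAMING: bookkeeping about an explicit 1-D model operator attached to a HYPOTHETICAL filament skeleton on the NEGATIVE side of a MODEL route;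
nothing here bears on Navier–Stokes regularity or blow-up; 23610/23612 stay OPEN.
-/

noncomputable section

open MeasureTheory Real Complex Filter Set
open scoped ComplexConjugate Topology
open Summit.NavierStokesRegularity.NavierStokesRegularity.Theorems.AnalyticStripLiaSymbol (liaSym)

namespace Summit.NavierStokesRegularity.NavierStokesRegularity.Theorems.MatchedKernel
set_option linter.dupNamespace false

/-! ## §1 Derivatives of the transition kernel -/

/-- `g = t k′ + k` has `g′ = 2k′ + t k″`. [folklore] -/
theorem hasDerivAt_transitionKernel {k k' k'' : ℝ → ℝ} (hk : ∀ t, HasDerivAt k (k' t) t) (hk' : ∀ t, HasDerivAt k' (k'' t) t) (t : ℝ) :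
    HasDerivAt (fun s => s * k' s + k s) (2 * k' t + t * k'' t) t := by
  have h1 : HasDerivAt (fun s : ℝ => s * k' s) (1 * k' t + t * k'' t) t := (hasDerivAt_id' t).mul (hk' t)
  exact (h1.add (hk t)).congr_deriv (by ring)

/-- `g′ = 2k′ + t k″` has `g″ = 3k″ + t k‴`. [folklore] -/
theorem hasDerivAt_transitionKernel_deriv {k' k'' k''' : ℝ → ℝ} (hk' : ∀ t, HasDerivAt k' (k'' t) t) (hk'' : ∀ t, HasDerivAt k'' (k''' t) t)
    (t : ℝ) : HasDerivAt (fun s => 2 * k' s + s * k'' s) (3 * k'' t + t * k''' t) t := by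
  have h1 : HasDerivAt (fun s : ℝ => s * k'' s) (1 * k'' t + t * k''' t) t := (hasDerivAt_id' t).mul (hk'' t)
  exact (((hk' t).const_mul 2).add h1).congr_deriv (by ring)

/-! ## §2 The sup of the transition piece -/

/-- ★ **SUP OF THE TRANSITION PIECE THROUGH THE WINDOW GAIN.**  `q, G, κ > 0`; `k` real `C³` (`k‴` continuous) with the transition kernel
`g = t k′ + k` and `g′ = 2k′ + t k″`, `g″ = 3k″ + t k‴` bounded/integrable as listed; the transition profile `χ_T(z) = ∫ g e^{izt}` supported where the
symbol is one-signed of size `≥ κ`; `Y ∈ C¹_c`; slip and multipliers as in `model_piece_window_estimate`.  Then at every `x`: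
`G·κ·‖P_T(x)‖² ≤ √(E_g · E_{g′})`. [folklore] -/
theorem transitionPiece_normSq_le {q G κ : ℝ} (hq : 0 < q) (hG : 0 < G) (hκ : 0 < κ)
    {k k' k'' k''' : ℝ → ℝ} (hk : ∀ t, HasDerivAt k (k' t) t) (hk' : ∀ t, HasDerivAt k' (k'' t) t) (hk'' : ∀ t, HasDerivAt k'' (k''' t) t)
    (hk'''c : Continuous k''')
    (hgi : Integrable fun t => t * k' t + k t) (hg'i : Integrable fun t => 2 * k' t + t * k'' t)
    (hg''i : Integrable fun t => 3 * k'' t + t * k''' t)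
    (hg1 : Integrable fun t => t * (t * k' t + k t)) (hg'1 : Integrable fun t => t * (2 * k' t + t * k'' t))
    (hg''1 : Integrable fun t => t * (3 * k'' t + t * k''' t))
    {Mg Mg' : ℝ} (hgM : ∀ t, |t * k' t + k t| ≤ Mg) (hg'M : ∀ t, |2 * k' t + t * k'' t| ≤ Mg')
    {χT : ℝ → ℂ} (hgχ : ∀ z : ℝ, ∫ t : ℝ, (((t * k' t + k t : ℝ)) : ℂ) * cexp (I * z * t) = χT z)
    (hsym : (∀ z : ℝ, χT z ≠ 0 → 2 / q * liaSym (z * √q) ≤ -κ) ∨ (∀ z : ℝ, χT z ≠ 0 → κ ≤ 2 / q * liaSym (z * √q)))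
    {Y : ℝ → ℂ} (hY : ContDiff ℝ 1 Y) (hYs : HasCompactSupport Y) (c : ℝ)
    {w : ℝ → ℝ} (hw : Differentiable ℝ w) {Λ : ℝ} (hΛ : ∀ t, |deriv w t| ≤ Λ) (hwc : w c = 0)
    {β₁ β₂ : ℝ → ℂ} (hβ₁c : Continuous β₁) (hβ₂c : Continuous β₂) {b₁ b₂ L₁ L₂ : ℝ}
    (hb₁ : ∀ τ, ‖β₁ τ‖ ≤ b₁) (hb₂ : ∀ τ, ‖β₂ τ‖ ≤ b₂) (hL₁ : ∀ x y, ‖β₁ y - β₁ x‖ ≤ L₁ * |y - x|) (hL₂ : ∀ x y, ‖β₂ y - β₂ x‖ ≤ L₂ * |y - x|)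
    (x : ℝ) :
    G * κ * ‖∫ y : ℝ, (((x - y) * k' (x - y) + k (x - y) : ℝ) : ℂ) * Y y‖ ^ 2
      ≤ Real.sqrt (
        (((∫ t, |t * k' t + k t|) * (∫ y : ℝ, ‖I * (G : ℂ) * ((2 / q : ℂ) * Y y
              - ∫ σ : ℝ, ((((2 * q - (y - σ) ^ 2) * (((y - σ) ^ 2 + q) ^ (5 / 2 : ℝ))⁻¹ : ℝ)) : ℂ) * Y σ)
            - ((w y : ℝ) : ℂ) * deriv Y y + β₁ y * Y y + β₂ y * conj (Y y)‖ ^ 2) ^ (1 / 2 : ℝ)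
          + (Λ * ((∫ t, |t| * |2 * k' t + t * k'' t|) + ∫ t, |t * k' t + k t|) + (L₁ + L₂) * (∫ t, |t| * |t * k' t + k t|)
              + (b₁ + b₂) * (∫ t, |t * k' t + k t|) + Real.sqrt 2 * Λ * ∫ t, |t| * |2 * k' t + t * k'' t|) * (∫ y : ℝ, ‖Y y‖ ^ 2) ^ (1 / 2 : ℝ)
          + Real.sqrt 2 * Λ * (∫ t, |2 * k' t + t * k'' t|) * (∫ y : ℝ, ‖(((y - c : ℝ) : ℂ)) * Y y‖ ^ 2) ^ (1 / 2 : ℝ))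
        * ((∫ t, |t * k' t + k t|) * (∫ y : ℝ, ‖Y y‖ ^ 2) ^ (1 / 2 : ℝ)))
        *
        (((∫ t, |2 * k' t + t * k'' t|) * (∫ y : ℝ, ‖I * (G : ℂ) * ((2 / q : ℂ) * Y y
              - ∫ σ : ℝ, ((((2 * q - (y - σ) ^ 2) * (((y - σ) ^ 2 + q) ^ (5 / 2 : ℝ))⁻¹ : ℝ)) : ℂ) * Y σ)
            - ((w y : ℝ) : ℂ) * deriv Y y + β₁ y * Y y + β₂ y * conj (Y y)‖ ^ 2) ^ (1 / 2 : ℝ)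
          + (Λ * ((∫ t, |t| * |3 * k'' t + t * k''' t|) + ∫ t, |2 * k' t + t * k'' t|) + (L₁ + L₂) * (∫ t, |t| * |2 * k' t + t * k'' t|)
              + (b₁ + b₂) * (∫ t, |2 * k' t + t * k'' t|) + Real.sqrt 2 * Λ * ∫ t, |t| * |3 * k'' t + t * k''' t|)
              * (∫ y : ℝ, ‖Y y‖ ^ 2) ^ (1 / 2 : ℝ)
          + Real.sqrt 2 * Λ * (∫ t, |3 * k'' t + t * k''' t|) * (∫ y : ℝ, ‖(((y - c : ℝ) : ℂ)) * Y y‖ ^ 2) ^ (1 / 2 : ℝ))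
        * ((∫ t, |2 * k' t + t * k'' t|) * (∫ y : ℝ, ‖Y y‖ ^ 2) ^ (1 / 2 : ℝ)))) := by
  have hk''c : Continuous k'' := continuous_iff_continuousAt.2 fun t => (hk'' t).continuousAt
  have hg''c : Continuous fun t : ℝ => 3 * k'' t + t * k''' t := (continuous_const.mul hk''c).add (continuous_id.mul hk'''c)
  exact normSq_windowPiece_le (k := fun t => t * k' t + k t) (k' := fun t => 2 * k' t + t * k'' t) (k'' := fun t => 3 * k'' t + t * k''' t)
    hq hG hκ (hasDerivAt_transitionKernel hk hk') (hasDerivAt_transitionKernel_deriv hk' hk'') hg''c hgi hg'i hg''i hg1 hg'1 hg''1 hgM hg'M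
    hgχ hsym hY hYs c hw hΛ hwc hβ₁c hβ₂c hb₁ hb₂ hL₁ hL₂ x

end Summit.NavierStokesRegularity.NavierStokesRegularity.Theorems.MatchedKernel

end
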